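import Summits.ResolutionOfSingularities.ResolutionOfSingularities.Theorems.FrobeniusLadderFInjectiveMacaulayficationRMonoidNodeCharts
import Summits.ResolutionOfSingularities.ResolutionOfSingularities.Theorems.FrobeniusLadderFInjectiveMacaulayficationSegreNodeBinomial
import Summits.ResolutionOfSingularities.ResolutionOfSingularities.Theorems.FrobeniusLadderFInjectiveMacaulayficationSegreConeFull
import Summits.ResolutionOfSingularities.ResolutionOfSingularities.Theorems.FrobeniusLadderFInjectiveMacaulayficationWFixAtNonClosedDimTwo
import HarnessLib

/-!
# (T-I3b) (B-L)(i-c): THE THREE `𝔸¹ × node` CHARTS OF `X₁ = Bl_{Sing_red} U_R` ARE FULL AT EVERY CLOSED POINT, EVERY PRIME `p`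
# (crux `FInjectiveMacaulayfication` stmt-ResolutionOfSingularities-15315, chain w45a, door v41.1; res-L1-w45a-plan-1 RULING R23.7 (B-L)(i); seat res-L1-w45a-lead-1 g12)

[OURS · L1 W4.5a] Support file (`--supports stmt-ResolutionOfSingularities-15315 --as helper`); replaces the role of NO printed item; NOT a statement of any manuscript;
def-free; UNCONDITIONAL; no named fact. AI-written (AI review is weaker than expert review). Nothing of the crux is proved here.

★ `fullCl_stalk_nodeChart` — on the floor `X₁ = Bl_J U_R` of T″-instance #6 (`RMonoidDefs.rDatum / rJ`, `k` of characteristic `p`), every CLOSED point `y` of the Rees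
charts `D₊(cc_l t)`, `l ∈ {3,5,6}` (`cc_l = x₁x₃, x₁x₂²x₃x₄, x₁²x₂²x₃x₄`) satisfies the crux's stalk clause `FullCl p 𝒪_{X₁,y}` (domain ∧ CM clause ∧ F-clause).
ASSEMBLY of ✓`RMonoidNodeCharts.exists_isOpenImmersion_nodeChart_rDatum` (the chart is the image of an open immersion from `Spec (Ring k PEmpty D_seg)`),
✓`SegreNodeBinomial.nonempty_ringEquiv_binomial` (`Ring k PEmpty D_seg ≅ k[X₀..X₄]/(X₀X₁ − X₂X₃)`), ✓`SegreConeFull.clause_xy_sub_zw` (Fedder: the clause at every maximal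
ideal of `k[X]/(X₀X₁ − X₂X₃)`), and stalk bookkeeping (`Spec.stalkIso`, stalk maps of open immersions are isomorphisms, closed point ↦ maximal ideal).
HONEST BILLING: this is the (B-L)(i) entry of the non-vacuity ledger of instance #6 — the three `𝔸¹ × node` charts are FULL at closed points; the three `≅ U_R` charts
(★ LOOP LEMMA `…RMonoidLoop`) are FULL iff `U_R` is, which is the RESERVED print T-TOR (hypothesis-form, not claimed); the regular chart `l = 1` and non-closed
points are not treated here. Nothing of T″ / the F-half is proved.
[folklore assembly; cite: Fedder1983, Prop. 1.7 (context); StacksProject, Tag 0804; Tag 01J5 (open immersions and stalks)]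
-/

-- single-problem summit: the doubled namespace component is forced
set_option linter.dupNamespace false

noncomputable section

namespace Summit.ResolutionOfSingularities.ResolutionOfSingularities.Theorems.FInjectiveMacaulayfication.RMonoidNodeChartsFull

open CategoryTheory AlgebraicGeometry Literature.AlgebraicGeometry.Resolution MvPolynomial
open Summit.ResolutionOfSingularities.ResolutionOfSingularities.Theorems.FInjectiveMacaulayfication
open Summit.ResolutionOfSingularities.ResolutionOfSingularities.Theorems.WildQuotientResolution
open Summit.ResolutionOfSingularities.ResolutionOfSingularities.Theorems.WildQuotientResolution.ToricChart

/-- `FullCl` at the stalk of the TARGET of an open immersion, from `FullCl` at the stalk of the source. [plumbing] -/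
theorem fullCl_stalk_of_isOpenImmersion (p : ℕ) {X Y : Scheme.{0}} (f : X ⟶ Y) [IsOpenImmersion f] (x : X)
    (h : SliceableCentre.FullCl p (X.presheaf.stalk x)) : SliceableCentre.FullCl p (Y.presheaf.stalk (f.base x)) :=
  WFixAtNonClosedDimTwo.fullCl_of_ringEquiv p (asIso (f.stalkMap x)).commRingCatIsoToRingEquiv.symm h

/-- `FullCl` at every CLOSED point of `Spec (k[X₀..X₄]/(X₀X₁ − X₂X₃))`, every prime `p` (the domain half from an abstract ring isomorphism with a domain — here
`Ring k PEmpty D_seg` — so that no primality of the binomial is needed; the clause half is ✓`SegreConeFull.clause_xy_sub_zw`). [OURS · assembly] -/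
theorem fullCl_stalk_spec_binomial (p : ℕ) [Fact p.Prime] (k : Type) [Field k] [CharP k p] (g : MvPolynomial (Fin 5) k) (hg : g = X 0 * X 1 - X 2 * X 3)
    {B : Type} [CommRing B] [IsDomain B] (e : (MvPolynomial (Fin 5) k ⧸ Ideal.span {g}) ≃+* B)
    (q : Spec (.of (MvPolynomial (Fin 5) k ⧸ Ideal.span {g}))) (hq : IsClosed ({q} : Set (Spec (.of (MvPolynomial (Fin 5) k ⧸ Ideal.span {g}))))) :
    SliceableCentre.FullCl p ((Spec (.of (MvPolynomial (Fin 5) k ⧸ Ideal.span {g}))).presheaf.stalk q) := by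
  haveI : IsDomain (MvPolynomial (Fin 5) k ⧸ Ideal.span {g}) := MulEquiv.isDomain B e.toMulEquiv
  haveI : q.asIdeal.IsMaximal := (PrimeSpectrum.isClosed_singleton_iff_isMaximal q).mp hq
  haveI : IsDomain (Localization.AtPrime q.asIdeal) :=
    IsLocalization.isDomain_of_le_nonZeroDivisors _ q.asIdeal.primeCompl_le_nonZeroDivisors
  have hloc : SliceableCentre.FullCl p (Localization.AtPrime q.asIdeal) := ⟨inferInstance, SegreConeFull.clause_xy_sub_zw k p g hg q.asIdeal⟩
  exact WFixAtNonClosedDimTwo.fullCl_of_ringEquiv p (Spec.stalkIso (.of _) q).commRingCatIsoToRingEquiv.symm hloc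

/-- ★ **The three `𝔸¹ × node` charts of `X₁ = Bl_{Sing_red} U_R` are FULL at every closed point, every prime `p`.** For `l ∈ {3,5,6}` and every closed point `y`
of the Rees chart `D₊(cc_l t)` of `X₁ = Bl_J U_R` (`RMonoidDefs.rDatum / rJ`; `J = (wordElem (rJ l))_l = I(Sing_red U_R)`): `FullCl p 𝒪_{X₁,y}`. [OURS · assembly] -/
theorem fullCl_stalk_nodeChart (p : ℕ) [Fact p.Prime] (k : Type) [Field k] [CharP k p] (j₀ : Fin 7) (hj₀ : j₀ = 3 ∨ j₀ = 5 ∨ j₀ = 6)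
    (y : ↥(affineBlowup (Ideal.span (Set.range fun l : Fin 7 => wordElem k PEmpty RMonoidDefs.rDatum (RMonoidDefs.rJ l)))))
    (hy : y ∈ Proj.basicOpen (reesGrading (Ideal.span (Set.range fun l : Fin 7 => wordElem k PEmpty RMonoidDefs.rDatum (RMonoidDefs.rJ l))))
        (reesT (wordElem k PEmpty RMonoidDefs.rDatum (RMonoidDefs.rJ j₀))
          (Ideal.mem_span_range_self (f := fun l : Fin 7 => wordElem k PEmpty RMonoidDefs.rDatum (RMonoidDefs.rJ l)) (x := j₀))))
    (hyc : IsClosed ({y} : Set ↥(affineBlowup (Ideal.span (Set.range fun l : Fin 7 => wordElem k PEmpty RMonoidDefs.rDatum (RMonoidDefs.rJ l)))))) :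
    SliceableCentre.FullCl p ((affineBlowup (Ideal.span (Set.range fun l : Fin 7 => wordElem k PEmpty RMonoidDefs.rDatum (RMonoidDefs.rJ l)))).presheaf.stalk y) := by
  -- the chart as the image of `Spec (k[X]/(X₀X₁ − X₂X₃))`
  obtain ⟨e⟩ := SegreNodeBinomial.nonempty_ringEquiv_binomial k _ rfl (X 0 * X 1 - X 2 * X 3) rfl
  obtain ⟨ι, hι, hrange⟩ := RMonoidNodeCharts.exists_isOpenImmersion_nodeChart_rDatum k PEmpty _ rfl j₀ hj₀
  haveI := hι
  haveI : IsDomain (Ring k PEmpty (⟨![1, 1, 0, 0], ![![0, 1, 1, 0], ![0, 1, 0, 1], ![0, 1, 1, 1]]⟩ : ConeDatum 4 3)) := isDomain_ring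
  let ι' := Spec.map e.symm.toCommRingCatIso.hom ≫ ι
  have hrange' : ι'.opensRange = ι.opensRange := Scheme.Hom.opensRange_comp_of_isIso _ _
  have hy' : y ∈ (ι'.opensRange : Set _) := by rw [hrange', hrange]; exact hy
  obtain ⟨q, rfl⟩ := hy'
  have hq : IsClosed ({q} : Set _) := by
    have hpre : ι'.base ⁻¹' {ι'.base q} = {q} :=
      Set.ext fun z => ⟨fun hz => ι'.isOpenEmbedding.injective hz, fun hz => by rw [Set.mem_singleton_iff.mp hz]; rfl⟩
    rw [← hpre]
    exact hyc.preimage ι'.base.hom.continuous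
  exact fullCl_stalk_of_isOpenImmersion p ι' q (fullCl_stalk_spec_binomial p k _ rfl e q hq)

end Summit.ResolutionOfSingularities.ResolutionOfSingularities.Theorems.FInjectiveMacaulayfication.RMonoidNodeChartsFull

end
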